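import Mathlib
import Summits.Langlands.Langlands.Theorems.PhantomRMYoshidaResiduallyYoshidaLiftingTraceLimitUnique
import Literature.RepresentationTheory.Semisimple.IsotypicProjection
import Literature.RepresentationTheory.Semisimple.SubrepresentationEquiv
import Summits.Langlands.Langlands.Theorems.PhantomRMYoshidaResiduallyYoshidaLiftingSplitFrame

/-!
# Trace limits V — the residual idempotent (Jacobson density) and rigidity of endoscopic
# components for representations over `ℤ̄_p` (route `PhantomRMYoshida`, crux
# `ResiduallyYoshidaLifting` = stmt-Langlands-13639, line `endoscopic-crossing-euler`, Stub 4)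

Companion of `…TraceLimitUnique.lean` (`--supports stmt-Langlands-13639`), which proved rigidity of
endoscopic components GIVEN a residual idempotent `x₀ ∈ ℤ̄_p[Γ]` separating them.  Here:

* `exists_separating_element` — **Jacobson density**: for irreducible, non-equivalent matrix
  representations `a : Γ → GL_m(IsLocalRing.ResidueField (Valued.integer (PadicAlgCl p)))`, `d : Γ → GL_{m'}(IsLocalRing.ResidueField (Valued.integer (PadicAlgCl p)))` of a group over a field, some
  `e ∈ κ[Γ]` acts as `1` through `a` and as `0` through `d` (tree
  `Module.exists_smul_isotypicProjection`, Schur via Mathlib `LinearMap.bijective_or_eq_zero`);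
* `norm_trace_sub_trace_le_of_residuallyConj` (registered as `stub_endoComponentRigidityRep`) —
  **rigidity of endoscopic components for representations `Γ → GL(ℤ̄_p)`**: if
  `a, a' : Γ → GL_m(ℤ̄_p)`, `d, d' : Γ → GL_{m'}(ℤ̄_p)` have `‖(tr a + tr d)(g) - (tr a' + tr d')(g)‖ ≤ ε`
  on `Γ`, the reductions `a`, `d` are irreducible and non-equivalent, and `a'`, `d'` are conjugate
  to `a`, `d`, then `‖tr a(g) - tr a'(g)‖ ≤ ε` on `Γ` (lift `e` to `x₀ ∈ ℤ̄_p[Γ]` and apply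
  `norm_trace_sub_trace_le_of_residualIdempotent` to the linear extensions of `a, a', d, d'`).

`Γ` is any group; no continuity.  The residue field `κ = ℤ̄_p/𝔪` is Mathlib's
`IsLocalRing.ResidueField (Valued.integer (PadicAlgCl p))`; the lemma `residue = 0 ↔ ‖·‖ < 1` is the
landed `residue_eq_zero_iff_norm_lt_one` (`…SplitFrame.lean`).

References: N. Bourbaki, *Algèbre* VIII § 4 n° 2 (density); J. Bellaïche, G. Chenevier,
Astérisque 324 (2009), Prop. 1.5.1.
-/

noncomputable section

open scoped Matrix

namespace Summit.Langlands.Langlands.Cruxes.ResiduallyYoshidaLifting.EndoscopicCrossingEuler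

set_option linter.dupNamespace false

open Literature.RepresentationTheory.Semisimple

/-! ### Linear extension of a matrix representation to the group algebra -/

section GroupAlgebra

variable {R : Type} [CommRing R] {Γ : Type} [Group Γ] {m : Type} [Fintype m] [DecidableEq m]

/-- The linear extension `R[Γ] → M_m(R)` of `φ : Γ → GL_m(R)` on a group element. [folklore] -/
theorem lift_coe_single_one (φ : Γ →* GL m R) (g : Γ) :
    MonoidAlgebra.lift R (Matrix m m R) Γ ((Units.coeHom (Matrix m m R)).comp φ)
      (MonoidAlgebra.single g 1) = ((φ g : GL m R) : Matrix m m R) := by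
  rw [MonoidAlgebra.lift_single, one_smul]
  rfl

/-- The linear extension on a scalar `c·1 ∈ R[Γ]`. [folklore] -/
theorem lift_coe_single_one_left (φ : Γ →* GL m R) (c : R) :
    MonoidAlgebra.lift R (Matrix m m R) Γ ((Units.coeHom (Matrix m m R)).comp φ)
      (MonoidAlgebra.single 1 c) = c • (1 : Matrix m m R) := by
  rw [MonoidAlgebra.lift_single, MonoidHom.map_one]

/-- The linear extension commutes with change of coefficients along a ring homomorphism.
[folklore] -/
theorem map_lift_coe {S : Type} [CommRing S] (f : R →+* S) (φ : Γ →* GL m R) (x : MonoidAlgebra R Γ) :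
    (MonoidAlgebra.lift R (Matrix m m R) Γ ((Units.coeHom (Matrix m m R)).comp φ) x).map f =
      MonoidAlgebra.lift S (Matrix m m S) Γ
        ((Units.coeHom (Matrix m m S)).comp ((Matrix.GeneralLinearGroup.map f).comp φ))
        (MonoidAlgebra.mapRingHom Γ f x) := by
  have key : ((RingHom.mapMatrix f).comp
      (MonoidAlgebra.lift R (Matrix m m R) Γ ((Units.coeHom (Matrix m m R)).comp φ)).toRingHom) =
      (MonoidAlgebra.lift S (Matrix m m S) Γ
        ((Units.coeHom (Matrix m m S)).comp ((Matrix.GeneralLinearGroup.map f).comp φ))).toRingHom.comp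
        (MonoidAlgebra.mapRingHom Γ f) := by
    refine MonoidAlgebra.ringHom_ext (fun c => ?_) (fun g => ?_)
    · simp only [RingHom.comp_apply, AlgHom.toRingHom_eq_coe, RingHom.coe_coe,
        MonoidAlgebra.mapRingHom_single, lift_coe_single_one_left, RingHom.mapMatrix_apply]
      ext i j
      by_cases hij : i = j <;> simp [hij]
    · simp only [RingHom.comp_apply, AlgHom.toRingHom_eq_coe, RingHom.coe_coe,
        MonoidAlgebra.mapRingHom_single, map_one, lift_coe_single_one, RingHom.mapMatrix_apply]
      rfl
  exact congrFun (congrArg DFunLike.coe key) x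

/-- The linear extension of a conjugate `P φ P⁻¹` is the conjugate of the linear extension.
[folklore] -/
theorem lift_coe_conj (φ φ' : Γ →* GL m R) (P : GL m R)
    (h : ∀ g, ((φ' g : GL m R) : Matrix m m R) = (P : Matrix m m R) * (φ g : GL m R) * ((P⁻¹ : GL m R) : Matrix m m R))
    (x : MonoidAlgebra R Γ) :
    MonoidAlgebra.lift R (Matrix m m R) Γ ((Units.coeHom (Matrix m m R)).comp φ') x =
      (P : Matrix m m R) * MonoidAlgebra.lift R (Matrix m m R) Γ ((Units.coeHom (Matrix m m R)).comp φ) x *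
        ((P⁻¹ : GL m R) : Matrix m m R) := by
  induction x using MonoidAlgebra.induction_on with
  | hM g => rw [MonoidAlgebra.of_apply, lift_coe_single_one, lift_coe_single_one, h g]
  | hadd x y hx hy => rw [map_add, map_add, hx, hy, Matrix.mul_add, Matrix.add_mul]
  | hsmul c x hx => rw [map_smul, map_smul, hx, Matrix.mul_smul, Matrix.smul_mul]

/-- `mapRingHom` along a surjective coefficient map is surjective. [folklore] -/
theorem mapRingHom_surjective {S : Type} [CommRing S] (f : R →+* S) (hf : Function.Surjective f) :
    Function.Surjective (MonoidAlgebra.mapRingHom Γ f) := by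
  intro y
  induction y using MonoidAlgebra.induction_on with
  | hM g => exact ⟨MonoidAlgebra.of R Γ g, by
      rw [MonoidAlgebra.of_apply, MonoidAlgebra.of_apply, MonoidAlgebra.mapRingHom_single, map_one]⟩
  | hadd x y hx hy =>
    obtain ⟨x', rfl⟩ := hx; obtain ⟨y', rfl⟩ := hy
    exact ⟨x' + y', map_add _ _ _⟩
  | hsmul c x hx =>
    obtain ⟨x', rfl⟩ := hx; obtain ⟨c', rfl⟩ := hf c
    refine ⟨MonoidAlgebra.single 1 c' * x', ?_⟩
    rw [map_mul, MonoidAlgebra.mapRingHom_single, Algebra.smul_def, MonoidAlgebra.coe_algebraMap,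
      Function.comp_apply, Algebra.algebraMap_self_apply]

end GroupAlgebra

/-! ### Jacobson density: an element of the group algebra separating two irreducibles -/

section Density

variable {κ : Type} [Field κ] {Γ : Type} [Group Γ] {m m' : Type} [Fintype m] [DecidableEq m]
  [Fintype m'] [DecidableEq m']

/-- The linear extension of `φ` to `κ[Γ]` is the matrix of the algebra representation
`ρ.asAlgebraHom` of the representation `ρ` on `κᵐ` through `φ`. [folklore] -/
theorem lift_coe_eq_toMatrix'_asAlgebraHom (φ : Γ →* GL m κ) (x : MonoidAlgebra κ Γ) :
    MonoidAlgebra.lift κ (Matrix m m κ) Γ ((Units.coeHom (Matrix m m κ)).comp φ) x =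
      LinearMap.toMatrix'
        ((Representation.asAlgebraHom ((Representation.ofDistribMulAction κ (GL m κ) (m → κ)).comp φ) x :
          Module.End κ (m → κ))) := by
  induction x using MonoidAlgebra.induction_on with
  | hM g =>
    rw [MonoidAlgebra.of_apply, lift_coe_single_one, ← MonoidAlgebra.of_apply,
      Representation.asAlgebraHom_of]
    have hlin : (((Representation.ofDistribMulAction κ (GL m κ) (m → κ)).comp φ) g :
        (m → κ) →ₗ[κ] (m → κ)) = Matrix.toLin' ((φ g : GL m κ) : Matrix m m κ) :=
      LinearMap.ext fun v ↦ by rw [Matrix.toLin'_apply]; rfl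
    rw [hlin, LinearMap.toMatrix'_toLin']
  | hadd x y hx hy => rw [map_add, map_add, hx, hy, map_add]
  | hsmul c x hx => rw [map_smul, map_smul, hx, map_smul]

/-- **Jacobson density for two non-equivalent irreducibles.**  Let `a : Γ → GL_mκ` and
`d : Γ → GL_{m'}κ` be irreducible as representations on `κᵐ`, `κ^{m'}` and NOT equivalent.  Then
some `e ∈ κ[Γ]` acts as the identity through `a` and as `0` through `d`: the `κ[Γ]`-modules are
simple with `Hom(κᵐ, κ^{m'}) = 0` (Schur, Mathlib `LinearMap.bijective_or_eq_zero`), so the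
isotypic projection of `κᵐ × κ^{m'}` onto `κᵐ` comes from the algebra
(tree `Module.exists_smul_isotypicProjection`).
[cite: BourbakiAlgebreVIII2012, VIII § 4 n° 2 and § 20 n° 6 Prop. 6 (p. 375)] -/
theorem exists_separating_element (a : Γ →* GL m κ) (d : Γ →* GL m' κ)
    (ha : Representation.IsIrreducible ((Representation.ofDistribMulAction κ (GL m κ) (m → κ)).comp a))
    (hd : Representation.IsIrreducible ((Representation.ofDistribMulAction κ (GL m' κ) (m' → κ)).comp d))
    (hne : IsEmpty (Representation.Equiv ((Representation.ofDistribMulAction κ (GL m κ) (m → κ)).comp a)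
      ((Representation.ofDistribMulAction κ (GL m' κ) (m' → κ)).comp d))) :
    ∃ e : MonoidAlgebra κ Γ,
      MonoidAlgebra.lift κ (Matrix m m κ) Γ ((Units.coeHom (Matrix m m κ)).comp a) e = 1 ∧
      MonoidAlgebra.lift κ (Matrix m' m' κ) Γ ((Units.coeHom (Matrix m' m' κ)).comp d) e = 0 := by
  set ρa : Representation κ Γ (m → κ) :=
    (Representation.ofDistribMulAction κ (GL m κ) (m → κ)).comp a with hρa
  set ρd : Representation κ Γ (m' → κ) :=
    (Representation.ofDistribMulAction κ (GL m' κ) (m' → κ)).comp d with hρd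
  haveI : ρa.IsIrreducible := ha
  haveI : ρd.IsIrreducible := hd
  haveI hsa : IsSimpleModule (MonoidAlgebra κ Γ) ρa.asModule :=
    (Representation.irreducible_iff_isSimpleModule_asModule ρa).mp ha
  haveI hsd : IsSimpleModule (MonoidAlgebra κ Γ) ρd.asModule :=
    (Representation.irreducible_iff_isSimpleModule_asModule ρd).mp hd
  haveI : IsSimpleModule (MonoidAlgebra κ Γ) (⊤ : Submodule (MonoidAlgebra κ Γ) ρa.asModule) :=
    IsSimpleModule.congr Submodule.topEquiv
  have hSN : ∀ f : (⊤ : Submodule (MonoidAlgebra κ Γ) ρa.asModule) →ₗ[MonoidAlgebra κ Γ] ρd.asModule,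
      f = 0 := by
    intro f
    rcases LinearMap.bijective_or_eq_zero
        (f ∘ₗ (Submodule.topEquiv : (⊤ : Submodule (MonoidAlgebra κ Γ) ρa.asModule) ≃ₗ[MonoidAlgebra κ Γ]
          ρa.asModule).symm.toLinearMap) with hb | h0
    · exact (hne.false (Representation.Equiv.ofAsModuleLinearEquiv (LinearEquiv.ofBijective _ hb))).elim
    · refine LinearMap.ext fun x => ?_
      have := LinearMap.congr_fun h0 (Submodule.topEquiv x)
      rw [LinearMap.comp_apply, LinearEquiv.coe_toLinearMap, LinearEquiv.symm_apply_apply] at this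
      simpa using this
  obtain ⟨r, hrN, hrM, -⟩ :=
    Module.exists_smul_isotypicProjection κ (⊤ : Submodule (MonoidAlgebra κ Γ) ρa.asModule) hSN
  have hall : ∀ x : ρa.asModule, r • x = x := fun x =>
    hrM x (Submodule.le_isotypicComponent (⊤ : Submodule (MonoidAlgebra κ Γ) ρa.asModule) Submodule.mem_top)
  refine ⟨r, ?_, ?_⟩
  · rw [lift_coe_eq_toMatrix'_asAlgebraHom, ← LinearMap.toMatrix'_id]
    congr 1
    refine LinearMap.ext fun v => ?_
    have := congrArg ρa.asModuleEquiv (hall (ρa.asModuleEquiv.symm v))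
    rwa [Representation.asModuleEquiv_map_smul, LinearEquiv.apply_symm_apply] at this
  · rw [lift_coe_eq_toMatrix'_asAlgebraHom, ← map_zero LinearMap.toMatrix']
    congr 1
    refine LinearMap.ext fun v => ?_
    have := congrArg ρd.asModuleEquiv (hrN (ρd.asModuleEquiv.symm v))
    rwa [Representation.asModuleEquiv_map_smul, LinearEquiv.apply_symm_apply, map_zero] at this

/-- **Registered sub-goal `stub_separatingElement` of Stub 4** (the statement through which this helper
file lands, `--supports stmt-Langlands-13639`; = `exists_separating_element` in closed form): Jacobson
density for two non-equivalent irreducible matrix representations. [folklore] -/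
theorem stub_separatingElement :
    ∀ (κ : Type) [Field κ] (Γ : Type) [Group Γ] (m m' : Type) [Fintype m] [DecidableEq m] [Fintype m'] [DecidableEq m'] (a : Γ →* GL m κ) (d : Γ →* GL m' κ), Representation.IsIrreducible ((Representation.ofDistribMulAction κ (GL m κ) (m → κ)).comp a) → Representation.IsIrreducible ((Representation.ofDistribMulAction κ (GL m' κ) (m' → κ)).comp d) → IsEmpty (Representation.Equiv ((Representation.ofDistribMulAction κ (GL m κ) (m → κ)).comp a) ((Representation.ofDistribMulAction κ (GL m' κ) (m' → κ)).comp d)) → ∃ e : MonoidAlgebra κ Γ, MonoidAlgebra.lift κ (Matrix m m κ) Γ ((Units.coeHom (Matrix m m κ)).comp a) e = 1 ∧ MonoidAlgebra.lift κ (Matrix m' m' κ) Γ ((Units.coeHom (Matrix m' m' κ)).comp d) e = 0 :=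
  fun _ _ _ _ _ _ _ _ _ _ a d ha hd hne => exists_separating_element a d ha hd hne

end Density

/-! ### Rigidity of endoscopic components for representations over `ℤ̄_p` -/

section PadicRigidity

variable {p : ℕ} [Fact p.Prime] {Γ : Type} [Group Γ] {m m' : Type} [Fintype m] [DecidableEq m]
  [Fintype m'] [DecidableEq m']


omit [Fintype m] [DecidableEq m] in
/-- Entries of an integral matrix whose reduction is `0` have norm `< 1`. [folklore] -/
theorem norm_coe_apply_lt_one_of_map_residue_eq_zero {M : Matrix m m (Valued.integer (PadicAlgCl p))}
    (h : M.map (IsLocalRing.residue (Valued.integer (PadicAlgCl p))) = 0) (i j : m) :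
    ‖((M i j : (Valued.integer (PadicAlgCl p))) : PadicAlgCl p)‖ < 1 := by
  rw [← residue_eq_zero_iff_norm_lt_one]
  have := congrFun (congrFun h i) j
  rwa [Matrix.map_apply] at this

/-- The linear extension `ℤ̄_p[Γ] → M_m(ℚ̄_p)` of `φ : Γ → GL_m(ℤ̄_p)`, as used in
`norm_trace_sub_trace_le_of_residualIdempotent`: integral values. [folklore] -/
theorem norm_mapMatrix_lift_apply_le_one (φ : Γ →* GL m (Valued.integer (PadicAlgCl p)))
    (x : MonoidAlgebra (Valued.integer (PadicAlgCl p)) Γ) (i j : m) :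
    ‖((RingHom.mapMatrix (Valued.integer (PadicAlgCl p)).subtype).comp
        (MonoidAlgebra.lift (Valued.integer (PadicAlgCl p)) (Matrix m m (Valued.integer (PadicAlgCl p))) Γ
          ((Units.coeHom _).comp φ)).toRingHom x) i j‖ ≤ 1 := by
  rw [RingHom.comp_apply, RingHom.mapMatrix_apply, Matrix.map_apply]
  exact Valued.integer.mem_iff.mp (Subtype.coe_prop _)

/-- The linear extension on scalars: `c·1 ↦ c·1`. [folklore] -/
theorem mapMatrix_lift_single_one (φ : Γ →* GL m (Valued.integer (PadicAlgCl p)))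
    (c : (Valued.integer (PadicAlgCl p))) :
    (RingHom.mapMatrix (Valued.integer (PadicAlgCl p)).subtype).comp
        (MonoidAlgebra.lift (Valued.integer (PadicAlgCl p)) (Matrix m m (Valued.integer (PadicAlgCl p))) Γ
          ((Units.coeHom _).comp φ)).toRingHom (MonoidAlgebra.single 1 c) =
      (c : PadicAlgCl p) • (1 : Matrix m m (PadicAlgCl p)) := by
  rw [RingHom.comp_apply, AlgHom.toRingHom_eq_coe, RingHom.coe_coe, lift_coe_single_one_left,
    RingHom.mapMatrix_apply]
  ext i j
  by_cases hij : i = j <;> simp [hij]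

/-- The linear extension on a group element: trace `= tr φ(g)` in `ℚ̄_p`. [folklore] -/
theorem trace_mapMatrix_lift_single (φ : Γ →* GL m (Valued.integer (PadicAlgCl p))) (g : Γ) :
    ((RingHom.mapMatrix (Valued.integer (PadicAlgCl p)).subtype).comp
        (MonoidAlgebra.lift (Valued.integer (PadicAlgCl p)) (Matrix m m (Valued.integer (PadicAlgCl p))) Γ
          ((Units.coeHom _).comp φ)).toRingHom (MonoidAlgebra.single g 1)).trace =
      ((((φ g : GL m (Valued.integer (PadicAlgCl p))) : Matrix m m (Valued.integer (PadicAlgCl p))).trace :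
        (Valued.integer (PadicAlgCl p))) : PadicAlgCl p) := by
  rw [RingHom.comp_apply, AlgHom.toRingHom_eq_coe, RingHom.coe_coe, lift_coe_single_one,
    RingHom.mapMatrix_apply, ← AddMonoidHom.map_trace]
  rfl

set_option maxHeartbeats 400000 in
/-- **Rigidity of endoscopic components for representations over `ℤ̄_p`.**  Let `Γ` be a group,
`a, a' : Γ → GL_m(ℤ̄_p)`, `d, d' : Γ → GL_{m'}(ℤ̄_p)` homomorphisms with
`‖(tr a(g) + tr d(g)) - (tr a'(g) + tr d'(g))‖ ≤ ε` for all `g`.  Suppose that the reductions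
`ā, d̄ : Γ → GL(IsLocalRing.ResidueField (Valued.integer (PadicAlgCl p)))` (`κ = ℤ̄_p/𝔪`) are irreducible and not equivalent, and that `ā'`, `d̄'` are
conjugate to `ā`, `d̄`.  Then `‖tr a(g) - tr a'(g)‖ ≤ ε` for all `g`: Jacobson density
(`exists_separating_element`) gives `e ∈ κ[Γ]` acting as `1` through `ā` (hence through the conjugate
`ā'`) and as `0` through `d̄`, `d̄'`; any lift `x₀ ∈ ℤ̄_p[Γ]` of `e` is a residual idempotent
separating the components, and `norm_trace_sub_trace_le_of_residualIdempotent` applies to the linear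
extensions of `a, a', d, d'`.  This is the uniqueness of the decomposition of a residually
multiplicity-free pseudocharacter into its components, in quantitative form and over the
non-noetherian `ℤ̄_p`. [folklore] -/
theorem norm_trace_sub_trace_le_of_residuallyConj
    (a a' : Γ →* GL m (Valued.integer (PadicAlgCl p))) (d d' : Γ →* GL m' (Valued.integer (PadicAlgCl p)))
    {ε : ℝ}
    (hT : ∀ g : Γ, ‖(((((a g : GL m (Valued.integer (PadicAlgCl p))) : Matrix m m _).trace :
          (Valued.integer (PadicAlgCl p))) : PadicAlgCl p) +
        ((((d g : GL m' (Valued.integer (PadicAlgCl p))) : Matrix m' m' _).trace :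
          (Valued.integer (PadicAlgCl p))) : PadicAlgCl p)) -
        (((((a' g : GL m (Valued.integer (PadicAlgCl p))) : Matrix m m _).trace :
          (Valued.integer (PadicAlgCl p))) : PadicAlgCl p) +
        ((((d' g : GL m' (Valued.integer (PadicAlgCl p))) : Matrix m' m' _).trace :
          (Valued.integer (PadicAlgCl p))) : PadicAlgCl p))‖ ≤ ε)
    (hac : Representation.IsIrreducible
      ((Representation.ofDistribMulAction (IsLocalRing.ResidueField (Valued.integer (PadicAlgCl p)))
        (GL m (IsLocalRing.ResidueField (Valued.integer (PadicAlgCl p))))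
        (m → (IsLocalRing.ResidueField (Valued.integer (PadicAlgCl p))))).comp
        ((Matrix.GeneralLinearGroup.map (IsLocalRing.residue (Valued.integer (PadicAlgCl p)))).comp a)))
    (hdc : Representation.IsIrreducible
      ((Representation.ofDistribMulAction (IsLocalRing.ResidueField (Valued.integer (PadicAlgCl p)))
        (GL m' (IsLocalRing.ResidueField (Valued.integer (PadicAlgCl p))))
        (m' → (IsLocalRing.ResidueField (Valued.integer (PadicAlgCl p))))).comp
        ((Matrix.GeneralLinearGroup.map (IsLocalRing.residue (Valued.integer (PadicAlgCl p)))).comp d)))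
    (hne : IsEmpty (Representation.Equiv
      ((Representation.ofDistribMulAction (IsLocalRing.ResidueField (Valued.integer (PadicAlgCl p)))
        (GL m (IsLocalRing.ResidueField (Valued.integer (PadicAlgCl p))))
        (m → (IsLocalRing.ResidueField (Valued.integer (PadicAlgCl p))))).comp
        ((Matrix.GeneralLinearGroup.map (IsLocalRing.residue (Valued.integer (PadicAlgCl p)))).comp a))
      ((Representation.ofDistribMulAction (IsLocalRing.ResidueField (Valued.integer (PadicAlgCl p)))
        (GL m' (IsLocalRing.ResidueField (Valued.integer (PadicAlgCl p))))
        (m' → (IsLocalRing.ResidueField (Valued.integer (PadicAlgCl p))))).comp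
        ((Matrix.GeneralLinearGroup.map (IsLocalRing.residue (Valued.integer (PadicAlgCl p)))).comp d))))
    (hac' : ∃ P : GL m (IsLocalRing.ResidueField (Valued.integer (PadicAlgCl p))), ∀ g,
      ((((Matrix.GeneralLinearGroup.map (IsLocalRing.residue (Valued.integer (PadicAlgCl p)))).comp a') g :
          GL m (IsLocalRing.ResidueField (Valued.integer (PadicAlgCl p)))) :
          Matrix m m (IsLocalRing.ResidueField (Valued.integer (PadicAlgCl p)))) =
        (P : Matrix m m (IsLocalRing.ResidueField (Valued.integer (PadicAlgCl p)))) *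
          ((((Matrix.GeneralLinearGroup.map (IsLocalRing.residue (Valued.integer (PadicAlgCl p)))).comp a) g :
            GL m (IsLocalRing.ResidueField (Valued.integer (PadicAlgCl p)))) :
            Matrix m m (IsLocalRing.ResidueField (Valued.integer (PadicAlgCl p)))) *
          ((P⁻¹ : GL m (IsLocalRing.ResidueField (Valued.integer (PadicAlgCl p)))) :
            Matrix m m (IsLocalRing.ResidueField (Valued.integer (PadicAlgCl p)))))
    (hdc' : ∃ Q : GL m' (IsLocalRing.ResidueField (Valued.integer (PadicAlgCl p))), ∀ g,
      ((((Matrix.GeneralLinearGroup.map (IsLocalRing.residue (Valued.integer (PadicAlgCl p)))).comp d') g :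
          GL m' (IsLocalRing.ResidueField (Valued.integer (PadicAlgCl p)))) :
          Matrix m' m' (IsLocalRing.ResidueField (Valued.integer (PadicAlgCl p)))) =
        (Q : Matrix m' m' (IsLocalRing.ResidueField (Valued.integer (PadicAlgCl p)))) *
          ((((Matrix.GeneralLinearGroup.map (IsLocalRing.residue (Valued.integer (PadicAlgCl p)))).comp d) g :
            GL m' (IsLocalRing.ResidueField (Valued.integer (PadicAlgCl p)))) :
            Matrix m' m' (IsLocalRing.ResidueField (Valued.integer (PadicAlgCl p)))) *
          ((Q⁻¹ : GL m' (IsLocalRing.ResidueField (Valued.integer (PadicAlgCl p)))) :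
            Matrix m' m' (IsLocalRing.ResidueField (Valued.integer (PadicAlgCl p)))))
    (g : Γ) :
    ‖((((a g : GL m (Valued.integer (PadicAlgCl p))) : Matrix m m _).trace :
          (Valued.integer (PadicAlgCl p))) : PadicAlgCl p) -
      ((((a' g : GL m (Valued.integer (PadicAlgCl p))) : Matrix m m _).trace :
          (Valued.integer (PadicAlgCl p))) : PadicAlgCl p)‖ ≤ ε := by
  -- the residual idempotent `e ∈ κ[Γ]` and a lift `x₀ ∈ ℤ̄_p[Γ]`
  obtain ⟨e, he1, he0⟩ := exists_separating_element ((Matrix.GeneralLinearGroup.map (IsLocalRing.residue (Valued.integer (PadicAlgCl p)))).comp a)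
    ((Matrix.GeneralLinearGroup.map (IsLocalRing.residue (Valued.integer (PadicAlgCl p)))).comp d) hac hdc hne
  obtain ⟨x₀, hx₀⟩ := mapRingHom_surjective (Γ := Γ) (IsLocalRing.residue (Valued.integer (PadicAlgCl p))) Ideal.Quotient.mk_surjective e
  obtain ⟨P, hP⟩ := hac'
  obtain ⟨Q, hQ⟩ := hdc'
  -- the linear extensions of `a, a', d, d'`
  set A := (RingHom.mapMatrix (Valued.integer (PadicAlgCl p)).subtype).comp
    (MonoidAlgebra.lift (Valued.integer (PadicAlgCl p)) (Matrix m m (Valued.integer (PadicAlgCl p))) Γ ((Units.coeHom _).comp a)).toRingHom with hA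
  set A' := (RingHom.mapMatrix (Valued.integer (PadicAlgCl p)).subtype).comp
    (MonoidAlgebra.lift (Valued.integer (PadicAlgCl p)) (Matrix m m (Valued.integer (PadicAlgCl p))) Γ ((Units.coeHom _).comp a')).toRingHom with hA'
  set D := (RingHom.mapMatrix (Valued.integer (PadicAlgCl p)).subtype).comp
    (MonoidAlgebra.lift (Valued.integer (PadicAlgCl p)) (Matrix m' m' (Valued.integer (PadicAlgCl p))) Γ ((Units.coeHom _).comp d)).toRingHom with hD
  set D' := (RingHom.mapMatrix (Valued.integer (PadicAlgCl p)).subtype).comp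
    (MonoidAlgebra.lift (Valued.integer (PadicAlgCl p)) (Matrix m' m' (Valued.integer (PadicAlgCl p))) Γ ((Units.coeHom _).comp d')).toRingHom with hD'
  -- residual values of the four extensions at `x₀`
  have ra : (MonoidAlgebra.lift (Valued.integer (PadicAlgCl p)) (Matrix m m (Valued.integer (PadicAlgCl p))) Γ ((Units.coeHom _).comp a) x₀).map (IsLocalRing.residue (Valued.integer (PadicAlgCl p))) = 1 := by
    rw [map_lift_coe, hx₀, he1]
  have ra' : (MonoidAlgebra.lift (Valued.integer (PadicAlgCl p)) (Matrix m m (Valued.integer (PadicAlgCl p))) Γ ((Units.coeHom _).comp a') x₀).map (IsLocalRing.residue (Valued.integer (PadicAlgCl p))) = 1 := by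
    rw [map_lift_coe, hx₀, lift_coe_conj ((Matrix.GeneralLinearGroup.map (IsLocalRing.residue (Valued.integer (PadicAlgCl p)))).comp a)
      ((Matrix.GeneralLinearGroup.map (IsLocalRing.residue (Valued.integer (PadicAlgCl p)))).comp a') P hP, he1, Matrix.mul_one, ← Units.val_mul,
      mul_inv_cancel, Units.val_one]
  have rd : (MonoidAlgebra.lift (Valued.integer (PadicAlgCl p)) (Matrix m' m' (Valued.integer (PadicAlgCl p))) Γ ((Units.coeHom _).comp d) x₀).map (IsLocalRing.residue (Valued.integer (PadicAlgCl p))) = 0 := by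
    rw [map_lift_coe, hx₀, he0]
  have rd' : (MonoidAlgebra.lift (Valued.integer (PadicAlgCl p)) (Matrix m' m' (Valued.integer (PadicAlgCl p))) Γ ((Units.coeHom _).comp d') x₀).map (IsLocalRing.residue (Valued.integer (PadicAlgCl p))) = 0 := by
    rw [map_lift_coe, hx₀, lift_coe_conj ((Matrix.GeneralLinearGroup.map (IsLocalRing.residue (Valued.integer (PadicAlgCl p)))).comp d)
      ((Matrix.GeneralLinearGroup.map (IsLocalRing.residue (Valued.integer (PadicAlgCl p)))).comp d') Q hQ, he0, Matrix.mul_zero, Matrix.zero_mul]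
  have h₀A : ∀ i j, ‖(A x₀ - 1) i j‖ < 1 := by
    intro i j
    have h1 : A x₀ - 1 = RingHom.mapMatrix (Valued.integer (PadicAlgCl p)).subtype
        (MonoidAlgebra.lift (Valued.integer (PadicAlgCl p)) (Matrix m m (Valued.integer (PadicAlgCl p))) Γ ((Units.coeHom _).comp a) x₀ - 1) := by
      rw [map_sub, map_one, hA, RingHom.comp_apply]
      rfl
    rw [h1, RingHom.mapMatrix_apply, Matrix.map_apply]
    refine norm_coe_apply_lt_one_of_map_residue_eq_zero ?_ i j
    rw [Matrix.map_sub _ (map_sub _), ra, Matrix.map_one _ (map_zero _) (map_one _), sub_self]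
  have h₀A' : ∀ i j, ‖(A' x₀ - 1) i j‖ < 1 := by
    intro i j
    have h1 : A' x₀ - 1 = RingHom.mapMatrix (Valued.integer (PadicAlgCl p)).subtype
        (MonoidAlgebra.lift (Valued.integer (PadicAlgCl p)) (Matrix m m (Valued.integer (PadicAlgCl p))) Γ ((Units.coeHom _).comp a') x₀ - 1) := by
      rw [map_sub, map_one, hA', RingHom.comp_apply]
      rfl
    rw [h1, RingHom.mapMatrix_apply, Matrix.map_apply]
    refine norm_coe_apply_lt_one_of_map_residue_eq_zero ?_ i j
    rw [Matrix.map_sub _ (map_sub _), ra', Matrix.map_one _ (map_zero _) (map_one _), sub_self]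
  have h₀D : ∀ i j, ‖D x₀ i j‖ < 1 := by
    intro i j
    rw [hD, RingHom.comp_apply, RingHom.mapMatrix_apply, Matrix.map_apply]
    exact norm_coe_apply_lt_one_of_map_residue_eq_zero rd i j
  have h₀D' : ∀ i j, ‖D' x₀ i j‖ < 1 := by
    intro i j
    rw [hD', RingHom.comp_apply, RingHom.mapMatrix_apply, Matrix.map_apply]
    exact norm_coe_apply_lt_one_of_map_residue_eq_zero rd' i j
  have key := norm_trace_sub_trace_le_of_residualIdempotent A A' D D'
    (norm_mapMatrix_lift_apply_le_one a) (norm_mapMatrix_lift_apply_le_one a')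
    (norm_mapMatrix_lift_apply_le_one d) (norm_mapMatrix_lift_apply_le_one d')
    (mapMatrix_lift_single_one a) (mapMatrix_lift_single_one a') (mapMatrix_lift_single_one d)
    (mapMatrix_lift_single_one d') (ε := ε) ?_ x₀ h₀A h₀D h₀A' h₀D' g
  · rwa [trace_mapMatrix_lift_single, trace_mapMatrix_lift_single] at key
  · intro g
    rw [trace_mapMatrix_lift_single, trace_mapMatrix_lift_single, trace_mapMatrix_lift_single,
      trace_mapMatrix_lift_single]
    exact hT g

end PadicRigidity

end Summit.Langlands.Langlands.Cruxes.ResiduallyYoshidaLifting.EndoscopicCrossingEuler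

end
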